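import Mathlib
import Literature.Combinatorics.Expanders.SlotGraphCuts
import Literature.Combinatorics.Expanders.SlotGraphCounting
import HarnessLib

/-!
# Bounded-degree edge expanders exist (Pinsker's counting argument in the slot model)

**Theorem** (`exists_bounded_degree_edgeExpander`). For every `N ≥ 2^18` there is a connected
graph on `Fin N` of maximum degree `≤ 514` in which every vertex set `U` with `|U| > N/8` and
`|V ∖ U| > N/8` has at least `2N` ordered pairs `(x, y)` with `x ∈ U`, `y ∉ U`, `x ~ y` — i.e.
at least `2N` boundary edges, edge expansion `≥ 16` on all medium sets.

In print (statement level): the existence of bounded-degree expanders by counting is Pinsker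
1973; the isoperimetric number of random `k`-regular graphs is `≥ k/2 - O(√k)` whp
(Bollobás 1988); [Chung1997] §6.1 (PDF pp. 71–72) and F. Chung in Bollobás (ed.) 1991, §2–3
(PDF pp. 36, 39: `i(G)`, Cor. 3.1 `i(G) ≥ k/2 - 2λ`). What is proved here is the crude-constant
version that is cheapest to kernel-check: the graph is the slot graph of a GOOD permutation of
`Fin N × Fin 256` (`exists_good_slotPerm`: fewer than `2^19` multi-edge triples and, for every
`U` with `N/8 < |U| ≤ N/2`, no `224|U|`-set of the `256|U|` slots of `U` mapped into the slots of
`U` — a union bound over `≤ 2^N` sets with failure `≤ (Nd)!/2^{N+2}` each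
(`card_bad_mul_two_pow_le`) plus Markov for multi-edges (`four_mul_card_manyMulti_le`)), plus a
Hamiltonian path; then every such `U` has `> 32|U|` cut events, hence
`≥ 32|U| + 2 - 2^19 ≥ 16|U| ≥ 2N` cut pairs (`card_cutEvents_le`), and the large side of a cut
is handled by symmetry. Degree `≤ 2·256 + 2`. The constants (`256`, `514`, `2^18`) are those of
the crude union bound and are NOT optimised (a random 64-regular graph would do).

Used by `Summits/PneNP/PneNP/Theorems/ReslinMediumCoverExpanderFamily.lean` (route support
`ExpanderFamily`: the graphs carrying the lifted Tseitin contradictions `τ(G,c)∘MAJ₃`).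

What is NOT here: explicit expanders (Margulis, Gabber–Galil, LPS), spectral expansion, vertex
expansion of small sets (see `Concentrator.lean`, `BoundedConcentrator.lean`), sharp constants.

## References
* [Chung1997] F. R. K. Chung, *Spectral Graph Theory* (1997), §6.1 (PDF pp. 71–72) — held.
* [BurgisserClausenShokrollahi1997] Lemma (13.32) (permutation model) — held.
* Pinsker 1973; Bollobás 1988 (Eur. J. Combin. 9, 241–244) — statement level, not held.
-/

namespace Literature.Combinatorics.Expanders

open Finset

/-! ### The union bound and the expander -/

section Assembly

/-- **A good slot permutation exists** (`d = 256` slots per vertex, `N ≥ 4`): fewer than `2^19`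
multi-edge triples, and for every `U` with `N/8 < |U| ≤ N/2` no `(7/8)|U|d`-set of slots of `U`
is mapped into the slots of `U`. Union bound: the first event fails for `≤ (Nd)!/4` permutations
(`four_mul_card_manyMulti_le`), each of the `≤ 2^N` others for `≤ (Nd)!/2^{64|U|} ≤ (Nd)!/2^{N+2}`
(`card_bad_mul_two_pow_le`). [folklore] -/
theorem exists_good_slotPerm (N : ℕ) (hN : 4 ≤ N) :
    ∃ π : Equiv.Perm (Fin N × Fin 256),
      ((univ : Finset (Fin N × Fin 256 × Fin 256)).filter fun t =>
          t.2.1 ≠ t.2.2 ∧ (π (t.1, t.2.1)).1 = (π (t.1, t.2.2)).1).card < 8 * 256 ^ 2 ∧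
      ∀ U : Finset (Fin N), N < 8 * U.card → 2 * U.card ≤ N →
        ¬ ∃ S ∈ powersetCard (U.card * 256 - U.card * 256 / 8) (U ×ˢ (univ : Finset (Fin 256))),
          ∀ p ∈ S, π p ∈ U ×ˢ (univ : Finset (Fin 256)) := by
  classical
  set M := N * 256 with hM
  set Q := (univ : Finset (Equiv.Perm (Fin N × Fin 256))).filter fun π =>
      8 * 256 ^ 2 ≤ ((univ : Finset (Fin N × Fin 256 × Fin 256)).filter fun t =>
        t.2.1 ≠ t.2.2 ∧ (π (t.1, t.2.1)).1 = (π (t.1, t.2.2)).1).card with hQ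
  set bad : Finset (Fin N) → Finset (Equiv.Perm (Fin N × Fin 256)) := fun U =>
    (univ : Finset (Equiv.Perm (Fin N × Fin 256))).filter fun π =>
      ∃ S ∈ powersetCard (U.card * 256 - U.card * 256 / 8) (U ×ˢ (univ : Finset (Fin 256))),
        ∀ p ∈ S, π p ∈ U ×ˢ (univ : Finset (Fin 256)) with hbad
  set I := (univ : Finset (Finset (Fin N))).filter fun U => N < 8 * U.card ∧ 2 * U.card ≤ N
    with hI
  have hQ4 : 4 * Q.card ≤ M.factorial := four_mul_card_manyMulti_le (by omega)
  have hbadU : ∀ U ∈ I, (bad U).card * 2 ^ (N + 2) ≤ M.factorial := by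
    intro U hU
    obtain ⟨h8, h2⟩ := (mem_filter.1 hU).2
    have h := card_bad_mul_two_pow_le (d := 256) U h2 (by omega)
    have hs : N + 2 ≤ 2 * (U.card * 256 / 8) := by omega
    exact (Nat.mul_le_mul_left _ (Nat.pow_le_pow_right (by norm_num) hs)).trans h
  have hIcard : I.card ≤ 2 ^ N :=
    (card_filter_le _ _).trans (by rw [card_univ, Fintype.card_finset, Fintype.card_fin])
  have hsum : 4 * ∑ U ∈ I, (bad U).card ≤ M.factorial := by
    refine Nat.le_of_mul_le_mul_right ?_ (pow_pos (by norm_num : (0:ℕ) < 2) N)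
    calc 4 * (∑ U ∈ I, (bad U).card) * 2 ^ N = ∑ U ∈ I, (bad U).card * 2 ^ (N + 2) := by
          rw [mul_assoc, mul_comm, sum_mul, sum_mul]
          refine sum_congr rfl fun U _ => ?_
          rw [pow_add]; ring
      _ ≤ ∑ U ∈ I, M.factorial := sum_le_sum hbadU
      _ = I.card * M.factorial := by rw [sum_const, smul_eq_mul]
      _ ≤ 2 ^ N * M.factorial := Nat.mul_le_mul_right _ hIcard
      _ = M.factorial * 2 ^ N := mul_comm _ _
  have hBcard : (Q ∪ I.biUnion bad).card < (univ : Finset (Equiv.Perm (Fin N × Fin 256))).card := by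
    rw [card_univ, Fintype.card_perm, Fintype.card_prod, Fintype.card_fin, Fintype.card_fin, ← hM]
    have h1 : (Q ∪ I.biUnion bad).card ≤ Q.card + ∑ U ∈ I, (bad U).card :=
      (card_union_le _ _).trans (Nat.add_le_add_left card_biUnion_le _)
    have h2 : 0 < M.factorial := Nat.factorial_pos _
    omega
  obtain ⟨π, -, hπ⟩ := exists_mem_notMem_of_card_lt_card hBcard
  rw [mem_union, not_or, mem_biUnion, not_exists] at hπ
  refine ⟨π, ?_, fun U h8 h2 hS => ?_⟩
  · have := hπ.1
    rw [hQ, mem_filter, not_and] at this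
    exact not_le.1 (this (mem_univ _))
  · refine hπ.2 U ⟨mem_filter.2 ⟨mem_univ _, h8, h2⟩, ?_⟩
    rw [hbad, mem_filter]
    exact ⟨mem_univ _, hS⟩

/-- **Bounded-degree edge expanders exist (Pinsker's counting argument, slot model).** For every
`N ≥ 2^18` there is a connected graph on `Fin N` of maximum degree `≤ 514` in which every vertex
set `U` with `|U| > N/8` and `|V ∖ U| > N/8` has at least `2N` ordered pairs `(x, y)`,
`x ∈ U`, `y ∉ U`, `x ~ y` (i.e. `≥ 2N` boundary edges; edge expansion `≥ 16` on medium sets).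
The graph is the slot graph of a good permutation of `Fin N × Fin 256` plus a Hamiltonian path;
the constants are those of the crude union bound and are not optimised. In print: Pinsker 1973
(existence of bounded-degree expanders/concentrators by counting); Bollobás 1988 (the
isoperimetric number of random regular graphs); cf. Hoory–Linial–Wigderson 2006 §1.2, §4.
[folklore] -/
theorem exists_bounded_degree_edgeExpander (N : ℕ) (hN : 2 ^ 18 ≤ N) :
    ∃ G : SimpleGraph (Fin N), ∃ _ : DecidableRel G.Adj,
      G.Connected ∧ (∀ v, G.degree v ≤ 514) ∧
      ∀ U : Finset (Fin N), N < 8 * U.card → N < 8 * Uᶜ.card →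
        2 * N ≤ ((U ×ˢ Uᶜ).filter fun e : Fin N × Fin N => G.Adj e.1 e.2).card := by
  classical
  obtain ⟨π, hmulti, hgood⟩ := exists_good_slotPerm N (by omega)
  let G : SimpleGraph (Fin N) := SimpleGraph.fromRel fun x y =>
    (∃ c : Fin 256, (π (x, c)).1 = y) ∨ x.val + 1 = y.val
  have hG : ∀ x y, G.Adj x y ↔ x ≠ y ∧ ((∃ c, (π (x, c)).1 = y ∨ (π (y, c)).1 = x) ∨
      x.val + 1 = y.val ∨ y.val + 1 = x.val) := by
    intro x y
    rw [SimpleGraph.fromRel_adj]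
    constructor
    · rintro ⟨hne, (⟨c, hc⟩ | h) | (⟨c, hc⟩ | h)⟩
      · exact ⟨hne, Or.inl ⟨c, Or.inl hc⟩⟩
      · exact ⟨hne, Or.inr (Or.inl h)⟩
      · exact ⟨hne, Or.inl ⟨c, Or.inr hc⟩⟩
      · exact ⟨hne, Or.inr (Or.inr h)⟩
    · rintro ⟨hne, ⟨c, hc | hc⟩ | h | h⟩
      · exact ⟨hne, Or.inl (Or.inl ⟨c, hc⟩)⟩
      · exact ⟨hne, Or.inr (Or.inl ⟨c, hc⟩)⟩
      · exact ⟨hne, Or.inl (Or.inr h)⟩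
      · exact ⟨hne, Or.inr (Or.inr h)⟩
  let inst : DecidableRel G.Adj := fun x y => decidable_of_iff _ (hG x y).symm
  refine ⟨G, inst, connected_of_slotGraph π G hG (by omega),
    fun v => degree_le_of_slotGraph π G hG v, ?_⟩
  -- the small side of the cut
  have hsmall : ∀ U : Finset (Fin N), N < 8 * U.card → 2 * U.card ≤ N →
      2 * N ≤ ((U ×ˢ Uᶜ).filter fun e : Fin N × Fin N => G.Adj e.1 e.2).card := by
    intro U h8 h2
    have hev := card_cutEvents_le π G hG U
    have hpart := card_cutEvents_add_card_inner π U (d := 256)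
    have hin := card_inner_lt_of_not_bad π U _ (hgood U h8 h2)
    have hk : U.card * 256 / 8 = 32 * U.card := by omega
    rw [hk] at hin
    omega
  intro U h8 h8c
  by_cases h2 : 2 * U.card ≤ N
  · exact hsmall U h8 h2
  · have hcc : Uᶜ.card = N - U.card := by rw [card_compl, Fintype.card_fin]
    have h2c : 2 * Uᶜ.card ≤ N := by omega
    have h := hsmall Uᶜ h8c h2c
    rw [compl_compl] at h
    refine h.trans (le_of_eq ?_)
    refine card_equiv (Equiv.prodComm (Fin N) (Fin N)) fun e => ?_
    simp only [mem_filter, mem_product, Equiv.prodComm_apply, Prod.fst_swap, Prod.snd_swap]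
    constructor
    · rintro ⟨⟨h1, h2⟩, h3⟩
      exact ⟨⟨h2, h1⟩, G.adj_symm h3⟩
    · rintro ⟨⟨h1, h2⟩, h3⟩
      exact ⟨⟨h2, h1⟩, G.adj_symm h3⟩

end Assembly

end Literature.Combinatorics.Expanders
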